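import Summits.CriticalPhenomena.CardyFormulaZ2.Theorems.CardyUSTContinuationSmallFugacityLimitContinuumChecks
import Summits.CriticalPhenomena.CardyFormulaZ2.Theorems.CardyUSTContinuationContinuumFamily

/-!
# `SmallFugacityLimit` (crux stmt-CriticalPhenomena-6048, route CardyUSTContinuation): the candidate
limit is consistent AT ORDER 1 with the proved item `KirchhoffExtremalLength`

Helper file (supports stmt-CriticalPhenomena-6048; closes nothing). The route's order-1 theorem
`KirchhoffExtremalLength` (item stmt-CriticalPhenomena-11234, PROVED in the tree) says that the
`t → 0⁺` slope of the jointly-wired crossing probability has crossing limit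
`s(η) = ₂F₁(½,½;1;η) / ₂F₁(½,½;1;1−η)` (the reciprocal extremal distance). The crux claims the full
limit is `U(t, η)` (Miller–Werner in joint wiring). The route header records the compatibility of the
two — "the κ = 8 slope of MW's formula equals the extremal length" — as a NUMERICAL check only
("ratio = 2K/K' to 1e-9"). Here it is proved: for every `η ∈ (0,1)`,
`U(t, η) / t → s(η)` as `t → 0⁺` (`tendsto_Umw_div_self`), i.e. `∂ₜU(0⁺, η) = s(η)`.
Proof: `U(t,η)/t = Z(u(t),η) / (Z(u(t),1−η) + t Z(u(t),η))` for `t > 0`; `u(t) = arccos(−t/2)/π → ½`;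
`u ↦ Z(u,x)` is continuous at `½` (restriction to real parameters of the holomorphic complexified
factor of `CardyUSTContinuationContinuumFamily`); and at `u = ½` both `rpow` exponents equal `¼`, so
`Z(½,η)/Z(½,1−η) = ₂F₁(½,½;1;η)/₂F₁(½,½;1;1−η)`. [cite: MillerWerner2018, §4]
-/

noncomputable section

namespace Summit.CriticalPhenomena.CardyFormulaZ2.Theorems

namespace SmallFugacityContinuum

open Set Filter Topology
open Literature.Probability.RandomPlanarGeometry (one_le_ordinaryHypergeometric_of_nonneg)
open ContinuumFamilyExt (differentiableAt_mwZc ofReal_mwZ)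

/-- Continuity of the Miller–Werner factor in its PARAMETER: for `x ∈ (0,1)` and a real `u₀` with
`|u₀| < 1`, `u₀ > 1/4`, the map `u ↦ Z(u, x)` is continuous at `u₀` (real trace of the holomorphic
complexified factor). [folklore] -/
theorem continuousAt_Zmw_param {x : ℝ} (hx : x ∈ Ioo (0:ℝ) 1) {u₀ : ℝ} (h1 : |u₀| < 1)
    (h2 : 1 / 4 < u₀) : ContinuousAt (fun u : ℝ => Zmw u x) u₀ := by
  have hreg : ‖(id (u₀ : ℂ))‖ < 1 ∧ 1 / 4 < (id (u₀ : ℂ)).re := by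
    refine ⟨?_, ?_⟩
    · simpa [Complex.norm_real, Real.norm_eq_abs] using h1
    · simpa using h2
  have hd : DifferentiableAt ℂ (fun p : ℂ => (x : ℂ) ^ (id p / 2) * (1 - (x : ℂ)) ^ (1 - 3 * id p / 2) *
      ₂F₁ (id p) (1 - id p) (2 * id p) (x : ℂ)) (u₀ : ℂ) :=
    differentiableAt_mwZc (v := id) hx differentiableAt_id hreg
  have hc : ContinuousAt (fun u : ℝ => ((Zmw u x : ℝ) : ℂ)) u₀ := by
    have h := hd.continuousAt.comp (Complex.continuous_ofReal.continuousAt (x := u₀))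
    refine (h.congr (Eventually.of_forall fun u => ?_))
    show (x : ℂ) ^ (id (u : ℂ) / 2) * (1 - (x : ℂ)) ^ (1 - 3 * id (u : ℂ) / 2) *
        ₂F₁ (id (u : ℂ)) (1 - id (u : ℂ)) (2 * id (u : ℂ)) (x : ℂ) = ((Zmw u x : ℝ) : ℂ)
    simp only [id]
    exact (ofReal_mwZ u hx.1.le hx.2.le).symm
  have hre := Complex.continuous_re.continuousAt.comp hc
  refine hre.congr (Eventually.of_forall fun u => ?_)
  simp only [Function.comp_apply, Complex.ofReal_re]

/-- The exponent map `t ↦ u(t) = arccos(−t/2)/π` is continuous. [folklore] -/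
theorem continuous_mwExponent : Continuous fun t : ℝ => Real.arccos (-(t / 2)) / Real.pi :=
  ((Real.continuous_arccos.comp ((continuous_id.div_const 2).neg)).div_const _)

/-- `u(0) = arccos(0)/π = ½` (the tree point `κ = 8`). [folklore] -/
theorem mwExponent_zero : Real.arccos (-((0:ℝ) / 2)) / Real.pi = 1 / 2 := by
  rw [zero_div, neg_zero, Real.arccos_zero]
  have hπ : Real.pi ≠ 0 := Real.pi_pos.ne'
  field_simp

/-- At `u = ½` the two `rpow` exponents coincide (`¼`) and the ratio of Miller–Werner factors is the
ratio of the `κ = 8` Gauss functions: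
`Z(½,η)/Z(½,1−η) = ₂F₁(½,½;1;η)/₂F₁(½,½;1;1−η)`. [folklore] -/
theorem Zmw_half_ratio {η : ℝ} (hη : η ∈ Ioo (0:ℝ) 1) :
    Zmw (1 / 2) η / Zmw (1 / 2) (1 - η) =
      ₂F₁ (1 / 2 : ℝ) (1 / 2) 1 η / ₂F₁ (1 / 2 : ℝ) (1 / 2) 1 (1 - η) := by
  have hη' : (1 - η) ∈ Ioo (0:ℝ) 1 := ⟨by linarith [hη.2], by linarith [hη.1]⟩
  show η ^ ((1 / 2 : ℝ) / 2) * (1 - η) ^ (1 - 3 * (1 / 2 : ℝ) / 2) *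
        ₂F₁ (1 / 2 : ℝ) (1 - 1 / 2) (2 * (1 / 2)) η /
      ((1 - η) ^ ((1 / 2 : ℝ) / 2) * (1 - (1 - η)) ^ (1 - 3 * (1 / 2 : ℝ) / 2) *
        ₂F₁ (1 / 2 : ℝ) (1 - 1 / 2) (2 * (1 / 2)) (1 - η)) =
      ₂F₁ (1 / 2 : ℝ) (1 / 2) 1 η / ₂F₁ (1 / 2 : ℝ) (1 / 2) 1 (1 - η)
  rw [sub_sub_cancel]
  have he1 : (1 / 2 : ℝ) / 2 = 1 / 4 := by norm_num
  have he2 : (1 : ℝ) - 3 * (1 / 2) / 2 = 1 / 4 := by norm_num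
  have hp1 : (1 : ℝ) - 1 / 2 = 1 / 2 := by norm_num
  have hp2 : (2 : ℝ) * (1 / 2) = 1 := by norm_num
  rw [he1, he2, hp1, hp2]
  have ha : 0 < η ^ (1 / 4 : ℝ) := Real.rpow_pos_of_pos hη.1 _
  have hb : 0 < (1 - η) ^ (1 / 4 : ℝ) := Real.rpow_pos_of_pos hη'.1 _
  have hF1 : 0 < ₂F₁ (1 / 2 : ℝ) (1 / 2) 1 η := by
    have := one_le_ordinaryHypergeometric_of_nonneg (a := (1/2:ℝ)) (b := 1/2) (c := 1)
      (by norm_num) (by norm_num) (by norm_num) hη.1.le hη.2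
    linarith
  have hF2 : 0 < ₂F₁ (1 / 2 : ℝ) (1 / 2) 1 (1 - η) := by
    have := one_le_ordinaryHypergeometric_of_nonneg (a := (1/2:ℝ)) (b := 1/2) (c := 1)
      (by norm_num) (by norm_num) (by norm_num) hη'.1.le hη'.2
    linarith
  rw [div_eq_div_iff (by positivity) hF2.ne']
  ring

/-- **Order-1 consistency of the dictionary (`∂ₜU(0⁺, η) = 1/λ(η)`).** For every `η ∈ (0,1)`,
`U(t, η) / t → ₂F₁(½,½;1;η) / ₂F₁(½,½;1;1−η)` as `t → 0⁺`: the first-order term of the crux's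
candidate limit is exactly the crossing-limit function of the PROVED order-1 item
`KirchhoffExtremalLength` (reciprocal extremal distance between the wired arcs).
[cite: MillerWerner2018, §4] -/
theorem tendsto_Umw_div_self {η : ℝ} (hη : η ∈ Ioo (0:ℝ) 1) :
    Tendsto (fun t => Umw t η / t) (𝓝[>] 0)
      (𝓝 (₂F₁ (1 / 2 : ℝ) (1 / 2) 1 η / ₂F₁ (1 / 2 : ℝ) (1 / 2) 1 (1 - η))) := by
  have hη' : (1 - η) ∈ Ioo (0:ℝ) 1 := ⟨by linarith [hη.2], by linarith [hη.1]⟩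
  set uf : ℝ → ℝ := fun t => Real.arccos (-(t / 2)) / Real.pi with huf
  have hu_cont : Continuous uf := continuous_mwExponent
  have hu0 : uf 0 = 1 / 2 := mwExponent_zero
  -- continuity at `t = 0` of the two factors through the exponent map
  have habs : |uf 0| < 1 := by rw [hu0]; norm_num [abs_of_pos]
  have hqrt : 1 / 4 < uf 0 := by rw [hu0]; norm_num
  have hZ1 : ContinuousAt (fun t => Zmw (uf t) η) 0 :=
    (continuousAt_Zmw_param hη habs hqrt).comp hu_cont.continuousAt
  have hZ2 : ContinuousAt (fun t => Zmw (uf t) (1 - η)) 0 :=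
    (continuousAt_Zmw_param hη' habs hqrt).comp hu_cont.continuousAt
  -- the reduced quotient `g t = Z(u(t),η) / (Z(u(t),1-η) + t Z(u(t),η))`
  set g : ℝ → ℝ := fun t => Zmw (uf t) η / (Zmw (uf t) (1 - η) + t * Zmw (uf t) η) with hg
  have hB0 : 0 < Zmw (uf 0) (1 - η) := by
    rw [hu0]; exact Zmw_pos (by norm_num) (by norm_num) hη'
  have hden0 : Zmw (uf 0) (1 - η) + 0 * Zmw (uf 0) η ≠ 0 := by
    rw [zero_mul, add_zero]; exact hB0.ne'
  have hg_cont : ContinuousAt g 0 :=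
    hZ1.div (hZ2.add (continuousAt_id.mul hZ1)) hden0
  have hlim : Tendsto g (𝓝[>] 0) (𝓝 (g 0)) :=
    hg_cont.tendsto.mono_left nhdsWithin_le_nhds
  have hg0 : g 0 = ₂F₁ (1 / 2 : ℝ) (1 / 2) 1 η / ₂F₁ (1 / 2 : ℝ) (1 / 2) 1 (1 - η) := by
    show Zmw (uf 0) η / (Zmw (uf 0) (1 - η) + 0 * Zmw (uf 0) η) = _
    rw [zero_mul, add_zero, hu0]
    exact Zmw_half_ratio hη
  -- `U(t,η)/t = g t` for `t ∈ (0, 2)`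
  have heq : g =ᶠ[𝓝[>] 0] fun t => Umw t η / t := by
    filter_upwards [Ioo_mem_nhdsGT (show (0:ℝ) < 2 by norm_num)] with t ht
    have hu' := arccos_div_pi_mem_Ioo ht
    have hA : 0 < Zmw (uf t) η := Zmw_pos (by linarith [hu'.1]) hu'.2.le hη
    have hB : 0 < Zmw (uf t) (1 - η) := Zmw_pos (by linarith [hu'.1]) hu'.2.le hη'
    have ht0 : 0 < t := ht.1
    show Zmw (uf t) η / (Zmw (uf t) (1 - η) + t * Zmw (uf t) η) =
      t * Zmw (uf t) η / (Zmw (uf t) (1 - η) + t * Zmw (uf t) η) / t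
    have hden : 0 < Zmw (uf t) (1 - η) + t * Zmw (uf t) η := by positivity
    field_simp
  rw [← hg0]
  exact hlim.congr' heq

end SmallFugacityContinuum

end Summit.CriticalPhenomena.CardyFormulaZ2.Theorems

end
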